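import Summits.QuantumFields.YangMills.Theorems.TwistedTraceScaling.Negative.WindowLargeFieldEntropy
import Summits.QuantumFields.YangMills.Theorems.TwistedTraceScaling.Negative.ClockRobustness
import HarnessLib

/-!
# `TwistedTraceScaling` (stmt-QuantumFields-20203, route `LuscherReduction`, skeleton «twolattice» rev 3, open stub `stub_cmpTwoLoop` ≡ LIM):
# prover-side support — THE ENTROPY THRESHOLD IS SCALE-INVARIANT ALONG THE ONE-LOOP TRAJECTORY; multi-scale union bounds on the femto window are
# UV-dominated below `2/b₀` (void, R80's regime at every blocking scale) and IR-ANCHORED above it (bounded by `C·e^{−δ/ḡ²(ℓ)}`, UNIFORMLY IN `L`)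

HONEST FRAMING: `--supports` helper for the OPEN crux `TwistedTraceScaling` (femto rung R2b1 of the CONDITIONAL reduction route `LuscherReduction`);
elementary real analysis on the tree's window labels; it proves nothing about Yang–Mills measures, closes no stub, and is not a mass-gap or Clay
statement.  No definition, no `Theses` import, no `sorry`.

CONTEXT.  The crux's one open stub is CMP-2LOOP `TwoLattice.Stmt.stub_cmpTwoLoop` ≡ LIM (✓`Negative.R75.cmpTwoLoop_iff_labelLimit`): Lüscher's zero-mode
trace asymptotics UNIFORMLY in the lattice size — the RG statement (W-REP + W-CMP + two-loop law of the true flow; not in print).  The disprover's R80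
(✓`Negative.R80`, `WindowLargeFieldEntropy`) certified the LARGE-FIELD ENTROPY THRESHOLD at the CUTOFF scale: on the window `W(lam, L)` the bare coupling is
pinned to the two-loop trajectory, `L⁴e^{−δβ}` is unbounded for `δ < 1/b₀` and `→ 0` for `δ > 1/b₀`; every per-plaquette event (`δ ≤ 4`) is abundant;
READING (R80): suppliers of CMP-2LOOP must be multi-scale.  THIS FILE is the prover-side, MULTI-SCALE form of that fact, in the tree's own running label
`x(ℓ) := invRunningCoupling β ℓ = 1/ḡ²(ℓa)` (one-loop running inverse coupling at the scale of `ℓ` lattice spacings; `x(1) = β/2 + (b₁/b₀)log(2b₀/β)` is the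
bare value, `x(L) ∈ [1/(8lam³), 1/lam³]` on `W(lam, L)`):

* §1 ★ EXACT SCALE COVARIANCE `x(ℓ) = x(L) + 2b₀ log(L/ℓ)` (`invRunningCoupling_scale`): inside the femto universe EVERY blocking scale `1 ≤ ℓ ≤ L` is weakly
  coupled, `x(ℓ) ≥ x(L) ≥ 1/(8lam³)`, uniformly in `L` (`invRunningCoupling_scale_ge_of_window`).
* §2 ★ THE SCALE-`ℓ` 4-VOLUME WEIGHT: `(L/ℓ)⁴ · e^{−δ·x(ℓ)} = (L/ℓ)^{4 − 2b₀δ} · e^{−δ·x(L)}` (`scaleWeight_eq`) — number of `ℓ`-blocks times the Boltzmann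
  factor of a defect costing `δ` in units of the RUNNING inverse coupling at that scale.  Hence the threshold `δ* = 2/b₀ = 48π²/11` (`two_div_b0_eq`; in
  R80's bare units `e^{−δβ}`, `β ≈ 2x(1)`, this is R80's `1/b₀`) is THE SAME AT EVERY SCALE: the exponent `4 − 2b₀δ` does not depend on `ℓ`.
* §3 BELOW THRESHOLD (`0 ≤ δ < 2/b₀`): the weight is largest at the cutoff `ℓ = 1`, where it is `≥ L^{4−2b₀δ}e^{−δ/lam³}` — unbounded along the window
  (`cutoffWeight_unbounded_below`); every dyadic multi-scale sum dominates its cutoff term (`dyadicSum_ge_cutoff`): NO union bound over any set of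
  scales containing the cutoff is uniform in `L` (R80's verdict, now at the level of the whole RG trajectory).
* §4 ★★ ABOVE THRESHOLD (`δ > 2/b₀`): EVERY scale's weight is `≤ e^{−δ·x(L)} ≤ e^{−δ/(8lam³)}` (`scaleWeight_le_above`, `scaleWeight_le_exp_depth`), and the
  dyadic multi-scale sum `Σ_{2^j ≤ L} (L/2^j)⁴ e^{−δ x(2^j)} ≤ e^{−δ x(L)}/(1 − 2^{−(2b₀δ−4)})` (`dyadicSum_le_above`) — IR-ANCHORED, BOUNDED UNIFORMLY IN `L`,
  exponentially small in the depth (`dyadicSum_le_exp_depth`); femto version with the time extent `T_s = ⌈sL/Λ⌉ ≤ (s/lam + 1)L`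
  (`femtoDyadicSum_le_exp_depth`).
* §5 summary `multiScale_entropy_dichotomy`.

READING (for suppliers of CMP-2LOOP ∕ LIM and the planner of a rev 4; a constraint on PROOFS, it refutes nothing): an `L`-uniform «no large field anywhere,
at any scale» event on the femto window exists exactly for defects charged MORE than `(2/b₀)·(1/ḡ²(ℓa))` per `ℓ`-block — `O(1)` field strengths in running
units; its failure probability is then IR-anchored, `≤ C(s/lam + 1)e^{−δ/(8lam³)}`, uniformly in `L`.  Bałaban's small-field thresholds `p(g_k)g_k → 0` are far
below this at every scale, so his renormalised expansions never exclude large fields globally: the large-field part of any supplier must be POLYMER-LOCAL at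
every scale (activities small per block, entropy `O(1)` per block), with only the gross `O(1)`-defect events available for global exclusion.  This is R80's
«multi-scale» reading made quantitative on the positive side; it does not move the open quantifier swap `∃ Λ0 ∀ L` of LIM.
-/

set_option autoImplicit false

noncomputable section

open MeasureTheory Filter Topology Real
open Literature.MathematicalPhysics.QuantumFieldTheory hiding SU2
open Literature.MathematicalPhysics.QuantumLattice
open Literature.Analysis.OperatorTheory.YMMatrixModel
open scoped BigOperators

namespace Summit.QuantumFields.YangMills.Theorems.FemtoTransferGap.MultiScaleEntropy

open Summit.QuantumFields.YangMills.Theorems.FemtoTransferGap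
open Summit.QuantumFields.YangMills.Theorems.FemtoTransferGap.TraceDoor
open Summit.QuantumFields.YangMills.Theorems.TwistedTraceScaling.Negative

/-! ## §1 Exact scale covariance of the running label -/

/-- ★ **Scale covariance of the one-loop running inverse coupling**: `1/ḡ²(ℓa) = 1/ḡ²(La) + 2b₀ log(L/ℓ)` — the tree's label at size `ℓ` and at size `L`
differ by the one-loop running between the two scales, exactly (both share the bare terms `β/2 + (b₁/b₀) log(2b₀/β)`). [cite: LuscherMunster1984, §2] -/
theorem invRunningCoupling_scale (β : ℝ) {ℓ L : ℕ} (hℓ : 0 < ℓ) (hL : 0 < L) :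
    invRunningCoupling β ℓ = invRunningCoupling β L + 2 * b0 * Real.log ((L : ℝ) / ℓ) := by
  have hℓ' : (ℓ : ℝ) ≠ 0 := by exact_mod_cast hℓ.ne'
  have hL' : (L : ℝ) ≠ 0 := by exact_mod_cast hL.ne'
  rw [BOHandover.invRunningCoupling_eq, BOHandover.invRunningCoupling_eq, Real.log_div hL' hℓ']
  ring

/-- Between scales `ℓ ≤ L` the running only adds: `1/ḡ²(La) ≤ 1/ḡ²(ℓa)` (asymptotic freedom, one loop, exact for the label). [cite: LuscherMunster1984, §2] -/
theorem invRunningCoupling_le_of_le (β : ℝ) {ℓ L : ℕ} (hℓ : 0 < ℓ) (hℓL : ℓ ≤ L) :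
    invRunningCoupling β L ≤ invRunningCoupling β ℓ := by
  have hL : 0 < L := lt_of_lt_of_le hℓ hℓL
  have hb0 : 0 < b0 := by unfold b0; positivity
  rw [invRunningCoupling_scale β hℓ hL]
  have h1 : (1 : ℝ) ≤ (L : ℝ) / ℓ := by
    rw [le_div_iff₀ (by exact_mod_cast hℓ)]
    simpa using (show (ℓ : ℝ) ≤ L by exact_mod_cast hℓL)
  have hlog : 0 ≤ Real.log ((L : ℝ) / ℓ) := Real.log_nonneg h1
  nlinarith

/-- ★ **Every blocking scale of the femto universe is weakly coupled, uniformly in `L`**: on `W(lam, L)`, for every `1 ≤ ℓ ≤ L`,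
`1/(8lam³) ≤ 1/ḡ²(La) ≤ 1/ḡ²(ℓa) = 1/ḡ²(La) + 2b₀ log(L/ℓ)`. [cite: LuscherMunster1984, §2] -/
theorem invRunningCoupling_scale_ge_of_window {lam β : ℝ} {ℓ L : ℕ} (hlam : 0 < lam) (hW : InFemtoWindow lam β L)
    (hℓ : 0 < ℓ) (hℓL : ℓ ≤ L) :
    1 / (8 * lam ^ 3) ≤ invRunningCoupling β ℓ ∧
      invRunningCoupling β ℓ = invRunningCoupling β L + 2 * b0 * Real.log ((L : ℝ) / ℓ) :=
  ⟨(invRunningCoupling_ge_of_window hlam hW).trans (invRunningCoupling_le_of_le β hℓ hℓL),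
    invRunningCoupling_scale β hℓ (lt_of_lt_of_le hℓ hℓL)⟩

/-! ## §2 The scale-`ℓ` 4-volume weight and the scale-invariant threshold `2/b₀` -/

/-- `2/b₀ = 48π²/11` — the threshold in running units (R80's `1/b₀ = 24π²/11` in bare units `β ≈ 2·(1/ḡ²)`; the Pugh–Teper number). [folklore] -/
theorem two_div_b0_eq : 2 / b0 = 48 * π ^ 2 / 11 := by
  unfold b0
  field_simp
  ring

/-- `42 < 2/b₀ < 44`. [folklore] -/
theorem two_div_b0_bounds : (42 : ℝ) < 2 / b0 ∧ 2 / b0 < 44 := by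
  have h := R80.inv_b0_bounds
  have h2 : (2 : ℝ) / b0 = 2 * (1 / b0) := by ring
  rw [h2]
  constructor <;> linarith [h.1, h.2]

/-- ★ **The scale-`ℓ` 4-volume weight along the one-loop trajectory**: `(L/ℓ)⁴ e^{−δ/ḡ²(ℓa)} = (L/ℓ)^{4 − 2b₀δ} e^{−δ/ḡ²(La)}` — the number of
`ℓ`-blocks times the Boltzmann factor of a defect charged `δ` running units at scale `ℓ` is a FIXED power of `L/ℓ` times the IR factor; the exponent
`4 − 2b₀δ` is the same at every scale. [folklore] -/
theorem scaleWeight_eq (β δ : ℝ) {ℓ L : ℕ} (hℓ : 0 < ℓ) (hL : 0 < L) :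
    ((L : ℝ) / ℓ) ^ 4 * Real.exp (-(δ * invRunningCoupling β ℓ))
      = ((L : ℝ) / ℓ) ^ (4 - 2 * b0 * δ : ℝ) * Real.exp (-(δ * invRunningCoupling β L)) := by
  have hq : (0 : ℝ) < (L : ℝ) / ℓ := by positivity
  rw [invRunningCoupling_scale β hℓ hL, R80.pow_four_eq_exp hq, Real.rpow_def_of_pos hq, ← Real.exp_add, ← Real.exp_add]
  congr 1
  ring

/-! ## §3 Below threshold: UV-dominated, unbounded along the window (R80's regime at every scale) -/

/-- Below threshold (`0 ≤ δ`, any `δ`) the weight is largest at the cutoff among scales `ℓ ≥ 1` when `2b₀δ ≤ 4`: `(L/ℓ)⁴e^{−δx(ℓ)} ≤ L⁴e^{−δx(1)}`.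
[folklore] -/
theorem scaleWeight_le_cutoff_below {β δ : ℝ} (hδ : 2 * b0 * δ ≤ 4) {ℓ L : ℕ} (hℓ : 0 < ℓ) (hℓL : ℓ ≤ L) :
    ((L : ℝ) / ℓ) ^ 4 * Real.exp (-(δ * invRunningCoupling β ℓ))
      ≤ (L : ℝ) ^ 4 * Real.exp (-(δ * invRunningCoupling β 1)) := by
  have hL : 0 < L := lt_of_lt_of_le hℓ hℓL
  have hLr : (0 : ℝ) < L := by exact_mod_cast hL
  have h1 := scaleWeight_eq β δ hℓ hL
  have h2 := scaleWeight_eq β δ Nat.one_pos hL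
  simp only [Nat.cast_one, div_one] at h2
  rw [h1, h2]
  apply mul_le_mul_of_nonneg_right _ (Real.exp_pos _).le
  exact Real.rpow_le_rpow (by positivity) (div_le_self hLr.le (by exact_mod_cast hℓ)) (by linarith)

/-- ★ **Below threshold the cutoff term alone is unbounded along the window**: for `0 ≤ δ < 2/b₀` and every `M`, `M ≤ L⁴ e^{−δ/ḡ²(a)}` on `W(lam, L)` for
all large `L` (`L⁴e^{−δx(1)} = L^{4−2b₀δ}e^{−δx(L)} ≥ L^{4−2b₀δ}e^{−δ/lam³}`). [folklore] -/
theorem cutoffWeight_unbounded_below {δ lam : ℝ} (hδ0 : 0 ≤ δ) (hδ : δ < 2 / b0) (hlam : 0 < lam) (M : ℝ) :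
    ∃ L1 : ℕ, ∀ (L : ℕ) [NeZero L], L1 ≤ L → ∀ β : ℝ, InFemtoWindow lam β L →
      M ≤ (L : ℝ) ^ 4 * Real.exp (-(δ * invRunningCoupling β 1)) := by
  have hb0 : 0 < b0 := by unfold b0; positivity
  have hη : 0 < 4 - 2 * b0 * δ := by
    have : b0 * δ < 2 := by rwa [lt_div_iff₀' hb0] at hδ
    linarith
  -- choose L with L^{η} ≥ max M 0 · e^{δ/lam³}
  set K : ℝ := max M 0 * Real.exp (δ * (1 / lam ^ 3)) with hK
  refine ⟨⌈Real.exp (Real.log (K + 1) / (4 - 2 * b0 * δ))⌉₊, fun L _ hL β hW => ?_⟩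
  have hLpos : (0 : ℝ) < L := by exact_mod_cast Nat.pos_of_ne_zero (NeZero.ne L)
  have hx := invRunningCoupling_le_of_window hlam hW
  have h2 := scaleWeight_eq β δ Nat.one_pos (Nat.pos_of_ne_zero (NeZero.ne L))
  simp only [Nat.cast_one, div_one] at h2
  rw [h2]
  have hK0 : 0 ≤ K := by positivity
  have hL2 : Real.exp (Real.log (K + 1) / (4 - 2 * b0 * δ)) ≤ (L : ℝ) := (Nat.le_ceil _).trans (by exact_mod_cast hL)
  have hlogL : Real.log (K + 1) / (4 - 2 * b0 * δ) ≤ Real.log (L : ℝ) := by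
    rw [Real.le_log_iff_exp_le hLpos]; exact hL2
  rw [div_le_iff₀ hη] at hlogL
  have hpow : K + 1 ≤ (L : ℝ) ^ (4 - 2 * b0 * δ : ℝ) := by
    rw [Real.rpow_def_of_pos hLpos]
    calc K + 1 = Real.exp (Real.log (K + 1)) := (Real.exp_log (by linarith)).symm
      _ ≤ _ := by rw [Real.exp_le_exp]; nlinarith [hlogL]
  have hexp : Real.exp (-(δ * (1 / lam ^ 3))) ≤ Real.exp (-(δ * invRunningCoupling β L)) := by
    rw [Real.exp_le_exp]
    nlinarith [hx.2, hδ0]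
  have hKe : K * Real.exp (-(δ * (1 / lam ^ 3))) = max M 0 := by
    rw [hK, mul_assoc, ← Real.exp_add]
    simp
  calc M ≤ max M 0 := le_max_left _ _
    _ = K * Real.exp (-(δ * (1 / lam ^ 3))) := hKe.symm
    _ ≤ (L : ℝ) ^ (4 - 2 * b0 * δ : ℝ) * Real.exp (-(δ * invRunningCoupling β L)) :=
        mul_le_mul (by linarith) hexp (Real.exp_pos _).le (by positivity)

/-- Every dyadic multi-scale sum dominates its cutoff term (all terms are non-negative). [folklore] -/
theorem dyadicSum_ge_cutoff (β δ : ℝ) (L J : ℕ) :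
    (L : ℝ) ^ 4 * Real.exp (-(δ * invRunningCoupling β 1))
      ≤ ∑ j ∈ Finset.range (J + 1), ((L : ℝ) / 2 ^ j) ^ 4 * Real.exp (-(δ * invRunningCoupling β (2 ^ j))) := by
  have h0 : 0 ∈ Finset.range (J + 1) := Finset.mem_range.2 (Nat.succ_pos J)
  have := Finset.single_le_sum (f := fun j => ((L : ℝ) / 2 ^ j) ^ 4 * Real.exp (-(δ * invRunningCoupling β (2 ^ j))))
    (fun j _ => by positivity) h0
  simpa using this

/-- ★ **Below threshold no multi-scale union bound containing the cutoff scale is uniform in `L`**: for `0 ≤ δ < 2/b₀`, every `M` and every choice of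
the number of scales `J(L)`, the dyadic sum exceeds `M` on `W(lam, L)` for all large `L`. [folklore] -/
theorem dyadicSum_unbounded_below {δ lam : ℝ} (hδ0 : 0 ≤ δ) (hδ : δ < 2 / b0) (hlam : 0 < lam) (M : ℝ) :
    ∃ L1 : ℕ, ∀ (L : ℕ) [NeZero L], L1 ≤ L → ∀ β : ℝ, InFemtoWindow lam β L → ∀ J : ℕ,
      M ≤ ∑ j ∈ Finset.range (J + 1), ((L : ℝ) / 2 ^ j) ^ 4 * Real.exp (-(δ * invRunningCoupling β (2 ^ j))) := by
  obtain ⟨L1, hL1⟩ := cutoffWeight_unbounded_below hδ0 hδ hlam M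
  exact ⟨L1, fun L _ hL β hW J => (hL1 L hL β hW).trans (dyadicSum_ge_cutoff β δ L J)⟩

/-! ## §4 Above threshold: IR-anchored, bounded uniformly in `L`, exponentially small in the depth -/

/-- ★ **Above threshold every scale's weight is bounded by the IR factor**: for `2b₀δ ≥ 4` and `1 ≤ ℓ ≤ L`, `(L/ℓ)⁴e^{−δx(ℓ)} ≤ e^{−δx(L)}`
(`(L/ℓ)^{4−2b₀δ} ≤ 1`). [folklore] -/
theorem scaleWeight_le_above {β δ : ℝ} (hδ : 4 ≤ 2 * b0 * δ) {ℓ L : ℕ} (hℓ : 0 < ℓ) (hℓL : ℓ ≤ L) :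
    ((L : ℝ) / ℓ) ^ 4 * Real.exp (-(δ * invRunningCoupling β ℓ)) ≤ Real.exp (-(δ * invRunningCoupling β L)) := by
  have hL : 0 < L := lt_of_lt_of_le hℓ hℓL
  rw [scaleWeight_eq β δ hℓ hL]
  have h1 : (1 : ℝ) ≤ (L : ℝ) / ℓ := by
    rw [le_div_iff₀ (by exact_mod_cast hℓ)]
    simpa using (show (ℓ : ℝ) ≤ L by exact_mod_cast hℓL)
  have hpow : ((L : ℝ) / ℓ) ^ (4 - 2 * b0 * δ : ℝ) ≤ 1 :=
    Real.rpow_le_one_of_one_le_of_nonpos h1 (by linarith)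
  calc ((L : ℝ) / ℓ) ^ (4 - 2 * b0 * δ : ℝ) * Real.exp (-(δ * invRunningCoupling β L))
      ≤ 1 * Real.exp (-(δ * invRunningCoupling β L)) := mul_le_mul_of_nonneg_right hpow (Real.exp_pos _).le
    _ = _ := one_mul _

/-- ★ **… hence by the depth, uniformly in `L`**: for `2b₀δ ≥ 4`, `δ ≥ 0`, on `W(lam, L)` and `1 ≤ ℓ ≤ L`: `(L/ℓ)⁴e^{−δx(ℓ)} ≤ e^{−δ/(8lam³)}`.
[folklore] -/
theorem scaleWeight_le_exp_depth {β δ lam : ℝ} (hδ : 4 ≤ 2 * b0 * δ) (hδ0 : 0 ≤ δ) (hlam : 0 < lam) {ℓ L : ℕ}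
    (hW : InFemtoWindow lam β L) (hℓ : 0 < ℓ) (hℓL : ℓ ≤ L) :
    ((L : ℝ) / ℓ) ^ 4 * Real.exp (-(δ * invRunningCoupling β ℓ)) ≤ Real.exp (-(δ / (8 * lam ^ 3))) := by
  refine (scaleWeight_le_above hδ hℓ hℓL).trans ?_
  rw [Real.exp_le_exp]
  have hx := invRunningCoupling_ge_of_window hlam hW
  have : δ * (1 / (8 * lam ^ 3)) ≤ δ * invRunningCoupling β L := mul_le_mul_of_nonneg_left hx hδ0
  have h8 : δ * (1 / (8 * lam ^ 3)) = δ / (8 * lam ^ 3) := by ring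
  linarith

/-- Geometric bookkeeping: for `η > 0` and `2^J ≤ L`, `Σ_{j ≤ J} (2^j/L)^η ≤ 1/(1 − 2^{−η})`. [folklore] -/
theorem dyadic_geom_le {η : ℝ} (hη : 0 < η) {L J : ℕ} (hL : 0 < L) (hJ : 2 ^ J ≤ L) :
    ∑ j ∈ Finset.range (J + 1), ((2 : ℝ) ^ j / L) ^ η ≤ 1 / (1 - (2 : ℝ) ^ (-η)) := by
  have hLr : (0 : ℝ) < L := by exact_mod_cast hL
  have hr0 : 0 < (2 : ℝ) ^ (-η) := Real.rpow_pos_of_pos (by norm_num) _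
  have hr1 : (2 : ℝ) ^ (-η) < 1 := Real.rpow_lt_one_of_one_lt_of_neg (by norm_num) (by linarith)
  -- term j ≤ (2^{-η})^{J-j}` since `2^j/L ≤ 2^j/2^J = (2^{J-j})⁻¹`
  have haux : ∀ n : ℕ, (((2 : ℝ) ^ n)⁻¹) ^ η = ((2 : ℝ) ^ (-η)) ^ n := by
    intro n
    rw [Real.inv_rpow (by positivity), ← Real.rpow_natCast (2 : ℝ) n, ← Real.rpow_mul (by norm_num),
      ← Real.rpow_natCast ((2 : ℝ) ^ (-η)) n, ← Real.rpow_mul (by norm_num), ← Real.rpow_neg (by norm_num)]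
    congr 1
    ring
  have hterm : ∀ j ∈ Finset.range (J + 1), ((2 : ℝ) ^ j / L) ^ η ≤ ((2 : ℝ) ^ (-η)) ^ (J - j) := by
    intro j hj
    have hjJ : j ≤ J := Nat.lt_succ_iff.mp (Finset.mem_range.mp hj)
    have h2J : ((2 : ℝ) ^ J) ≤ L := by exact_mod_cast hJ
    have hJ' : (2 : ℝ) ^ J = 2 ^ j * 2 ^ (J - j) := by rw [← pow_add, Nat.add_sub_cancel' hjJ]
    have hq : (2 : ℝ) ^ j / L ≤ ((2 : ℝ) ^ (J - j))⁻¹ := by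
      calc (2 : ℝ) ^ j / L ≤ (2 : ℝ) ^ j / 2 ^ J := div_le_div_of_nonneg_left (by positivity) (by positivity) h2J
        _ = ((2 : ℝ) ^ (J - j))⁻¹ := by rw [hJ']; field_simp
    calc ((2 : ℝ) ^ j / L) ^ η ≤ (((2 : ℝ) ^ (J - j))⁻¹) ^ η := Real.rpow_le_rpow (by positivity) hq hη.le
      _ = ((2 : ℝ) ^ (-η)) ^ (J - j) := haux (J - j)
  calc ∑ j ∈ Finset.range (J + 1), ((2 : ℝ) ^ j / L) ^ η
      ≤ ∑ j ∈ Finset.range (J + 1), ((2 : ℝ) ^ (-η)) ^ (J - j) := Finset.sum_le_sum hterm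
    _ = ∑ i ∈ Finset.range (J + 1), ((2 : ℝ) ^ (-η)) ^ i := by
        rw [← Finset.sum_range_reflect]
        refine Finset.sum_congr rfl fun i hi => ?_
        have hiJ : i ≤ J := Nat.lt_succ_iff.mp (Finset.mem_range.mp hi)
        congr 1
        omega
    _ ≤ ∑' i : ℕ, ((2 : ℝ) ^ (-η)) ^ i :=
        Summable.sum_le_tsum _ (fun i _ => by positivity) (summable_geometric_of_lt_one hr0.le hr1)
    _ = 1 / (1 - (2 : ℝ) ^ (-η)) := by rw [tsum_geometric_of_lt_one hr0.le hr1, one_div]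

/-- ★★ **Above threshold the dyadic multi-scale union bound is IR-anchored**: for `2b₀δ > 4` and `2^J ≤ L`,
`Σ_{j ≤ J} (L/2^j)⁴ e^{−δ/ḡ²(2^j a)} ≤ e^{−δ/ḡ²(La)}/(1 − 2^{−(2b₀δ − 4)})` — the sum over ALL blocking scales is a constant times the IR factor, for
every `L` and `β` (no window needed for the identity part). [folklore] -/
theorem dyadicSum_le_above {β δ : ℝ} (hδ : 4 < 2 * b0 * δ) {L J : ℕ} (hL : 0 < L) (hJ : 2 ^ J ≤ L) :
    ∑ j ∈ Finset.range (J + 1), ((L : ℝ) / 2 ^ j) ^ 4 * Real.exp (-(δ * invRunningCoupling β (2 ^ j)))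
      ≤ Real.exp (-(δ * invRunningCoupling β L)) / (1 - (2 : ℝ) ^ (-(2 * b0 * δ - 4))) := by
  have hη : 0 < 2 * b0 * δ - 4 := by linarith
  have hLr : (0 : ℝ) < L := by exact_mod_cast hL
  have hrw : ∀ j ∈ Finset.range (J + 1),
      ((L : ℝ) / 2 ^ j) ^ 4 * Real.exp (-(δ * invRunningCoupling β (2 ^ j)))
        = Real.exp (-(δ * invRunningCoupling β L)) * (((2 : ℝ) ^ j / L) ^ (2 * b0 * δ - 4)) := by
    intro j _
    have h2j : 0 < 2 ^ j := pow_pos (by norm_num) j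
    have h := scaleWeight_eq β δ h2j hL
    push_cast at h ⊢
    rw [h, mul_comm]
    congr 1
    have hq : (0 : ℝ) < (L : ℝ) / 2 ^ j := by positivity
    rw [show ((2 : ℝ) ^ j / L) = ((L : ℝ) / 2 ^ j)⁻¹ by rw [inv_div], Real.inv_rpow hq.le, ← Real.rpow_neg hq.le]
    ring_nf
  rw [Finset.sum_congr rfl hrw, ← Finset.mul_sum, div_eq_mul_one_div]
  exact mul_le_mul_of_nonneg_left (dyadic_geom_le hη hL hJ) (Real.exp_pos _).le

/-- ★★ **… hence BOUNDED UNIFORMLY IN `L` and exponentially small in the depth on the window**: for `2b₀δ > 4`, `δ ≥ 0`, on `W(lam, L)` and `2^J ≤ L`,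
`Σ_{j ≤ J} (L/2^j)⁴ e^{−δ/ḡ²(2^j a)} ≤ e^{−δ/(8lam³)}/(1 − 2^{−(2b₀δ−4)})`. [folklore] -/
theorem dyadicSum_le_exp_depth {β δ lam : ℝ} (hδ : 4 < 2 * b0 * δ) (hδ0 : 0 ≤ δ) (hlam : 0 < lam) {L J : ℕ}
    (hW : InFemtoWindow lam β L) (hL : 0 < L) (hJ : 2 ^ J ≤ L) :
    ∑ j ∈ Finset.range (J + 1), ((L : ℝ) / 2 ^ j) ^ 4 * Real.exp (-(δ * invRunningCoupling β (2 ^ j)))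
      ≤ Real.exp (-(δ / (8 * lam ^ 3))) / (1 - (2 : ℝ) ^ (-(2 * b0 * δ - 4))) := by
  have hη : 0 < 2 * b0 * δ - 4 := by linarith
  have hr1 : (2 : ℝ) ^ (-(2 * b0 * δ - 4)) < 1 := Real.rpow_lt_one_of_one_lt_of_neg (by norm_num) (by linarith)
  refine (dyadicSum_le_above hδ hL hJ).trans ?_
  apply div_le_div_of_nonneg_right _ (by linarith)
  rw [Real.exp_le_exp]
  have hx := invRunningCoupling_ge_of_window hlam hW
  have : δ * (1 / (8 * lam ^ 3)) ≤ δ * invRunningCoupling β L := mul_le_mul_of_nonneg_left hx hδ0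
  have h8 : δ * (1 / (8 * lam ^ 3)) = δ / (8 * lam ^ 3) := by ring
  linarith

/-- ★★ **Femto 4-volume version** (blocks of the femto torus `L³ × T_s`, `T_s = ⌈sL/Λ⌉ ≤ (s/lam + 1)·L` on the window): for `2b₀δ > 4`, `δ ≥ 0`, `s ≥ 0`,
`Σ_{j ≤ J} (L/2^j)³ (T_s/2^j) e^{−δ/ḡ²(2^j a)} ≤ (s/lam + 1) · e^{−δ/(8lam³)}/(1 − 2^{−(2b₀δ−4)})` on `W(lam, L)`, `2^J ≤ L` — UNIFORM IN `L`, and `→ 0`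
as `lam → 0`. [folklore] -/
theorem femtoDyadicSum_le_exp_depth {β δ lam s : ℝ} (hδ : 4 < 2 * b0 * δ) (hδ0 : 0 ≤ δ) (hlam : 0 < lam) (hs : 0 ≤ s)
    {L J : ℕ} [NeZero L] (hW : InFemtoWindow lam β L) (hJ : 2 ^ J ≤ L) :
    ∑ j ∈ Finset.range (J + 1),
        ((L : ℝ) / 2 ^ j) ^ 3 * ((femtoSteps s β L : ℝ) / 2 ^ j) * Real.exp (-(δ * invRunningCoupling β (2 ^ j)))
      ≤ (s / lam + 1) * (Real.exp (-(δ / (8 * lam ^ 3))) / (1 - (2 : ℝ) ^ (-(2 * b0 * δ - 4)))) := by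
  have hL : 0 < L := Nat.pos_of_ne_zero (NeZero.ne L)
  have hLr : (0 : ℝ) < L := by exact_mod_cast hL
  have hL1 : (1 : ℝ) ≤ L := by exact_mod_cast hL
  have hT := R80.femtoSteps_le_of_window hs hlam hW
  have hT' : (femtoSteps s β L : ℝ) ≤ (s / lam + 1) * L := by
    have h0 : s / lam * L = s * L / lam := div_mul_eq_mul_div s lam L
    have h0' : 0 ≤ s / lam := by positivity
    nlinarith [hT, h0, hL1, h0']
  have hrw : ∀ j ∈ Finset.range (J + 1),
      ((L : ℝ) / 2 ^ j) ^ 3 * ((femtoSteps s β L : ℝ) / 2 ^ j) * Real.exp (-(δ * invRunningCoupling β (2 ^ j)))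
        = ((femtoSteps s β L : ℝ) / L) * (((L : ℝ) / 2 ^ j) ^ 4 * Real.exp (-(δ * invRunningCoupling β (2 ^ j)))) := by
    intro j _
    have h2 : (0 : ℝ) < 2 ^ j := by positivity
    field_simp
  rw [Finset.sum_congr rfl hrw, ← Finset.mul_sum]
  have hratio : (femtoSteps s β L : ℝ) / L ≤ s / lam + 1 := by
    rw [div_le_iff₀ hLr]; exact hT'
  exact mul_le_mul hratio (dyadicSum_le_exp_depth hδ hδ0 hlam hW hL hJ) (Finset.sum_nonneg fun j _ => by positivity)
    (by positivity)

/-! ## §5 Summary -/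

/-- ★★ **THE ENTROPY THRESHOLD `2/b₀ = 48π²/11` (running units) IS SCALE-INVARIANT — multi-scale dichotomy on the two-loop femto window.**
Below it (`0 ≤ δ < 2/b₀`) every dyadic multi-scale union bound, with any number of scales, is unbounded along `W(lam, L)` (UV-dominated: R80's
cutoff-scale regime governs); above it (`δ > 2/b₀`) the union bound over ALL scales `2^j ≤ L` is `≤ e^{−δ/(8lam³)}/(1 − 2^{−(2b₀δ−4)})` at EVERY `L`
(IR-anchored).  Constraint on proofs of CMP-2LOOP ∕ LIM, not on the statement. [folklore] -/
theorem multiScale_entropy_dichotomy {lam : ℝ} (hlam : 0 < lam) {δ : ℝ} (hδ0 : 0 ≤ δ) :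
    (δ < 2 / b0 → ∀ M : ℝ, ∃ L1 : ℕ, ∀ (L : ℕ) [NeZero L], L1 ≤ L → ∀ β : ℝ, InFemtoWindow lam β L → ∀ J : ℕ,
        M ≤ ∑ j ∈ Finset.range (J + 1), ((L : ℝ) / 2 ^ j) ^ 4 * Real.exp (-(δ * invRunningCoupling β (2 ^ j)))) ∧
    (2 / b0 < δ → ∀ (L : ℕ) [NeZero L] (β : ℝ), InFemtoWindow lam β L → ∀ J : ℕ, 2 ^ J ≤ L →
        ∑ j ∈ Finset.range (J + 1), ((L : ℝ) / 2 ^ j) ^ 4 * Real.exp (-(δ * invRunningCoupling β (2 ^ j)))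
          ≤ Real.exp (-(δ / (8 * lam ^ 3))) / (1 - (2 : ℝ) ^ (-(2 * b0 * δ - 4)))) := by
  have hb0 : 0 < b0 := by unfold b0; positivity
  refine ⟨fun h M => dyadicSum_unbounded_below hδ0 h hlam M, fun h L _ β hW J hJ => ?_⟩
  have h4 : 4 < 2 * b0 * δ := by
    have : 2 < b0 * δ := by rwa [div_lt_iff₀' hb0] at h
    linarith
  exact dyadicSum_le_exp_depth h4 hδ0 hlam hW (Nat.pos_of_ne_zero (NeZero.ne L)) hJ

end Summit.QuantumFields.YangMills.Theorems.FemtoTransferGap.MultiScaleEntropy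

end
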